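import Summits.BirchSwinnertonDyer.BirchSwinnertonDyer.Theorems.EisensteinPrimesBSDpOnCellCOfNamedFactsV22
import Summits.BirchSwinnertonDyer.BirchSwinnertonDyer.Theorems.EisensteinPrimesBSDpOnCellCTelescopeK2WeightTwoOfPub
import Summits.BirchSwinnertonDyer.BirchSwinnertonDyer.Theorems.EisensteinPrimesBSDpOnCellCTelescopeK2DivIntOfModuleDiv
import Summits.BirchSwinnertonDyer.BirchSwinnertonDyer.Theorems.EisensteinPrimesBSDpOnCellCTelescopeK2WeightControl
import Summits.BirchSwinnertonDyer.BirchSwinnertonDyer.Theorems.EisensteinPrimesBSDpOnCellCTelescopeK2ControlAlgebra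
import Summits.BirchSwinnertonDyer.BirchSwinnertonDyer.Theorems.EisensteinPrimesBSDpOnCellCRetractionSpecializationHerbrand
import Summits.BirchSwinnertonDyer.BirchSwinnertonDyer.Theorems.EisensteinPrimesBSDpOnCellCRetractionSpecializationTorsion
import Literature.NumberTheory.EllipticCurves.IwasawaAlgebraRankOneIdealProofs
import Literature.NumberTheory.EllipticCurves.IwasawaSelmerIsTorsionProofs
import Literature.NumberTheory.IwasawaTheory.IwasawaAlgebraTwoVarRegularProofs
import HarnessLib
/-!
# [telescope v11 variant «Np» — LEAD cruxlead-19034 g3, 2026-08-30] THE N2|pub PORT for the v11 texts: fibre data with the strengthened (unr)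
# conjunct («… ∧ ∀ w ∈ S₀, p ∉ w → N ∈ w»); W1 (`TelescopeK2WeightTwoFg.bigModuleFinite`) and W3 (`TelescopeK2WeightTwoOfPub.weightTwoTransport_of_pub`)
# are called through the projection FD⁺ → FD. `Lines/telescope-v11-recipe.md`.
# Crux 4 `BSDpOnCellC` (stmt-BirchSwinnertonDyer-19034), line «telescope» v10, REGISTERED LEAF N2|pub `stub_weightTwoControlOfPub`
# REDUCED BY NAME TO ITS TWO OPEN SUB-LEAVES W2 (weight-two control map) AND W4 (purity): `W2 → W4 → N2|pub`
# (successor LEAD `cruxlead-19034` g3; `--supports`, helper; THEOREMS ONLY; closes no registered stub)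
HONEST FRAMING. No registered stub, no crux, no summit statement is proved; BSD is proved for no curve. This is the PORT of the fully proved
kernel `K2Weight2.weightTwoControl_of_subleaves : W1 → W2 → W3 → W4 → N2` of the crux workfile `Cruxes/BSDpOnCellC/Lines/telescopeK2weight2.lean`
(ideator bsd-idea-12 g34; pure module algebra by name on `RetractionSpecialization.*`, `TelescopeK2DivIntOfModuleDiv.C_X_dvd_of_map_constantCoeff_eq_zero`
and the tree's `charIdeal` calculus) to the REGISTERED leaf text N2|pub = `(<stub_publishedFacts>) → N2` of telescope v10, with the two sub-leaves
that are now TREE THEOREMS plugged in BY NAME: W1 = `TelescopeK2WeightTwoFg.bigModuleFinite` (ideator g37, p752319) and W3 =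
`TelescopeK2WeightTwoOfPub.weightTwoTransport_of_pub hGZK hnf` (this LEAD, CONDITIONAL on the refereed names `exists_isNewformOf` /
`rank_eq_analyticRank_of_analyticRank_le_one`, read off the cite stub as conjuncts 6 / 10: `hPub.1.1.1.1.2.2.2.2.2.1` / `hPub.1.1.1.1.2.2.2.2.2.2.2.2.2.1`).
What remains for N2|pub after this file, BY NAME: W2 `K2Weight2.stub_weightTwoControlMap` (x2-p2 g18/g19: in the tree under the Frobenius-
annihilator input (ann), `TelescopeK2WeightTwoControlMapOfFrobenius.exists_weightTwoControlMap_of_frobenius_of_heegner`) and W4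
`K2Weight2.stub_weightTwoPurity` (route G, ideator's `Lines/telescopeK2purity.lean`).
* **`weightTwoControlOfPub_of_controlMap_of_purity (h2 : <W2 verbatim>) (h4 : <W4 verbatim>) : <stub_weightTwoControlOfPub, registered text verbatim>`.**
References: R. Greenberg, Doc. Math. Extra Vol. Coates (2006) Prop. 3.2 [Greenberg2006]; F. Castella, Camb. J. Math. 6 (2018) Thm. 2.3, §2.2 and
the Erratum Lemma 2.1 [Castella2018] [Castella2018Erratum]; Jetchev–Skinner–Wan, Camb. J. Math. 5 (2017) Lemma 3.4.1 / Thm. 3.3.1 [JetchevSkinnerWan2017];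
Bourbaki, Alg. Comm. VII §4.5 Prop. 10 [BourbakiAC5to7].
-/
set_option autoImplicit false
set_option linter.dupNamespace false
noncomputable section
open scoped Classical MatrixGroups ModularForm

open CongruenceSubgroup WeierstrassCurve NumberField IsDedekindDomain Field PowerSeries
  Literature.NumberTheory.EllipticCurves Literature.NumberTheory.EllipticCurves.GreenbergSelmer
  Literature.NumberTheory.EllipticCurves.ModularForms Literature.NumberTheory.QuadraticFields
  Literature.NumberTheory.EllipticCurves.Rank1Residual
  Literature.NumberTheory.EllipticCurves.Rank1Residual.Typed
  Literature.NumberTheory.EllipticCurves.KrizLi2019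
  Literature.NumberTheory.EllipticCurves.GreenbergVatsal2000
  Literature.NumberTheory.EllipticCurves.Wuthrich2014
  Literature.NumberTheory.EllipticCurves.SteinWuthrich2013
  Literature.NumberTheory.EllipticCurves.Castella2018Exceptional
  Literature.NumberTheory.GaloisRepresentations Literature.NumberTheory.GaloisCohomology
  Literature.NumberTheory.Automorphic
  Summit.BirchSwinnertonDyer.Rank1Residual.X11b.AcSelmer
  Summit.BirchSwinnertonDyer.Rank1Residual.X11b.Halves
  Summit.BirchSwinnertonDyer.Rank1Residual.X11b
  Summit.BirchSwinnertonDyer.Rank1Residual Summit.BirchSwinnertonDyer.Rank1Residual.X1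
  Summit.BirchSwinnertonDyer.Rank1Residual.X2
open Literature.NumberTheory.EllipticCurves.KellerYin2024 (curveLocalLambda)

open Literature.NumberTheory.EllipticCurves.BigGaloisRep

namespace Summit.BirchSwinnertonDyer.BirchSwinnertonDyer.Theorems.TelescopeK2WeightTwoControlOfPubOfSubleavesNp

open Literature.NumberTheory.EllipticCurves.CastellaGrossiLeeSkinner2022 Literature.NumberTheory.EllipticCurves.Castella2018
  Literature.NumberTheory.IwasawaTheory Literature.NumberTheory.IwasawaTheory.Greenberg2016
  Literature.NumberTheory.IwasawaTheory.Greenberg2006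
  Summit.BirchSwinnertonDyer.Rank1Residual.X1.KellerYinMuLambdaSplit
open Literature.NumberTheory.EllipticCurves.KellerYin2024
open Summit.BirchSwinnertonDyer.BirchSwinnertonDyer.Theorems
set_option maxHeartbeats 1600000 in
/-- **N2|pub from W2 and W4 (W1, W3 by name)** — the registered leaf `stub_weightTwoControlOfPub` of telescope v10, token for token, from its
two still-open sub-leaves: the weight-two control map (W2, `h2`) and purity (W4, `h4`). Port of `K2Weight2.weightTwoControl_of_subleaves`.
[cite: Greenberg2006, Prop. 3.2] [cite: Castella2018, Thm. 2.3, §2.2] [cite: JetchevSkinnerWan2017, Thm. 3.3.1] [cite: BourbakiAC5to7, VII §4.5 Prop. 10] -/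
theorem weightTwoControlOfPub_of_controlMap_of_purity
    (h2 : ∀ (W : WeierstrassCurve ℚ) [W.IsElliptic] [W.IsGloballyMinimal] (p : ℕ) [Fact p.Prime],
    ∀ (N : ℕ) [NeZero N] (K : Type) [Field K] [NumberField K] (Dt : ModularParametrizationData W N)
      (H : HeegnerDatum N (NumberField.discr K)) (ιK : K →+* ℂ) (P : (W.baseChange K).toAffine.Point), CellC W p → W.conductorNorm ℤ = N →
      IsImaginaryQuadratic K → NumberField.discr K < -4 → SatisfiesHeegnerHypothesis N K →
      (W.quadraticTwist (NumberField.discr K : ℚ)).entireLFunction 1 ≠ 0 →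
      WeierstrassCurve.Affine.Point.map ιK.toRatAlgHom P = heegnerPointComplex Dt H → ¬ (p : ℤ) ∣ Dt.c → ¬ IsOfFinAddOrder P →
      Odd (NumberField.discr K) → ∀ (κ : ZpExtension K p), κ.IsAnticyclotomic → ∀ (γ : Field.absoluteGaloisGroup K) [Fact (κ.IsTopGenerator γ)]
          (𝔭 : HeightOneSpectrum (𝓞 K)), ((p : ℕ) : 𝓞 K) ∈ 𝔭.asIdeal → 𝔭.asIdeal.ramificationIdx (𝓞 ℚ) = 1 → 𝔭.asIdeal.inertiaDeg (𝓞 ℚ) = 1 →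
          ∀ (𝔭bar : HeightOneSpectrum (𝓞 K)), ((p : ℕ) : 𝓞 K) ∈ 𝔭bar.asIdeal → 𝔭bar ≠ 𝔭 → ((Ideal.span {(p : ℤ)}).primesOver (𝓞 K)).ncard = 2 →
          ∀ (f : CuspForm (CongruenceSubgroup.Gamma0 N) 2), IsNewformOf W f → ∀ (ι' : PadicAlgCl p ≃+* ℂ), (∀ (w : InfinitePlace K) (k : 𝓞 K),
                k ∈ 𝔭.asIdeal ↔ ‖ι'.symm (w.embedding (k : K))‖ < 1) → ∀ (ΩK : ℂ) (Ωp : ℂ_[p]) (Q : PowerSeries 𝓞_ℂ_[p]), ΩK ≠ 0 → ‖Ωp‖ = 1 →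
                R1.IsBDPLFunctionInt p ι' 𝔭 κ γ f ΩK Ωp Q →
      ∀ (L : PowerSeries (PowerSeries (unrIntegers p))) (x : ℕ → ℤ_[p]) (D : ℕ → Skinner2016.HidaCongruentForm W p 1),
        (∀ k, ‖x k‖ < 1) ∧ Filter.Tendsto x Filter.atTop (nhds 0) ∧ (∃ e : ℕ, PowerSeries.C ((p : 𝓞_ℂ_[p]) ^ e) * Q ∈
          Ideal.span {PowerSeries.map (R1.unrToCpInt p) (PowerSeries.map (PowerSeries.constantCoeff (R := unrIntegers p)) L)}) ∧
        (∀ k : ℕ, (∀ y : coeffField (D k).g, ι' ((D k).ι y) = (y : ℂ)) ∧ 2 * ((p : ℤ) - 1) ∣ (D k).k - 2 ∧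
          ∃ (ΩKg : ℂ) (Ωpg : ℂ_[p]) (Lg : UnrSeries p), ΩKg ≠ 0 ∧ ‖Ωpg‖ = 1 ∧ IsBDPLFunctionWt ι' 𝔭 κ γ (D k).g ΩKg Ωpg Lg ∧ ∃ Ψ : UnrSeries p,
            (∃ U : PowerSeries (PowerSeries (unrIntegers p)), PowerSeries.map (PowerSeries.C (R := unrIntegers p)) Ψ =
                L + PowerSeries.C (PowerSeries.X - PowerSeries.C (toUnr p (x k))) * U) ∧
            (∃ e : ℕ, PowerSeries.C ((p : 𝓞_ℂ_[p]) ^ e) * PowerSeries.map (R1.unrToCpInt p) Ψ ∈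
              Ideal.span {PowerSeries.map (R1.unrToCpInt p) Lg})) ∧ (∃ A : ℕ → UnrSeries p, ∀ ℓ : ℕ, ℓ.Prime → ¬ ℓ ∣ N →
          (∃ U : UnrSeries p, A ℓ = PowerSeries.C (toUnr p ((W.frobeniusTrace ℓ : ℤ) : ℤ_[p])) + PowerSeries.X * U) ∧
          ∀ k : ℕ, ∃ (c : unrIntegers p) (U : UnrSeries p), A ℓ = PowerSeries.C c + (PowerSeries.X - PowerSeries.C (toUnr p (x k))) * U ∧
            ((c : ℂ_[p]) = algebraMap (PadicAlgCl p) ℂ_[p]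
              ((D k).ι ⟨(UpperHalfPlane.qExpansion 1 ⇑(D k).g).coeff ℓ, coeff_mem_coeffField (D k).g ℓ⟩))) →
      ∀ [TopologicalSpace (PowerSeries ℤ_[p])] (A₂ : Type) [AddCommGroup A₂]
        [Module (PowerSeries ℤ_[p]) A₂] [TopologicalSpace A₂] [DiscreteTopology A₂]
        (ρ₂ : ContinuousRep (Field.absoluteGaloisGroup K) (PowerSeries ℤ_[p]) A₂) [TopologicalSpace (PowerSeries (PowerSeries ℤ_[p]))]
        [ContinuousSMul (PowerSeries (PowerSeries ℤ_[p])) (BigRepModule (PowerSeries ℤ_[p]) p A₂)]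
        [Module (PowerSeries ℤ_[p]) (XBig κ ρ₂ 𝔭bar (∅ : Set (HeightOneSpectrum (𝓞 K))))]
        [IsScalarTower (PowerSeries ℤ_[p]) (PowerSeries (PowerSeries ℤ_[p])) (XBig κ ρ₂ 𝔭bar (∅ : Set (HeightOneSpectrum (𝓞 K))))],
        ((∀ a : A₂, ∃ n : ℕ, (PowerSeries.X : PowerSeries ℤ_[p]) ^ n • a = 0) ∧ (∀ a : A₂, ∃ b : A₂, (PowerSeries.X : PowerSeries ℤ_[p]) • b = a) ∧
          (∀ (k : ℕ) (a : A₂), ∃ b : A₂, (PowerSeries.X - PowerSeries.C (x k)) • b = a) ∧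
          (∃ S₀ : Set (HeightOneSpectrum (𝓞 K)), S₀.Finite ∧ GaloisRep.IsUnramifiedOutside S₀ ρ₂ ∧
            ∀ w ∈ S₀, ((p : ℕ) : 𝓞 K) ∉ w.asIdeal → ((N : ℕ) : 𝓞 K) ∈ w.asIdeal) ∧
          (∃ θ₀ : Submodule.torsionBy (PowerSeries ℤ_[p]) A₂ (PowerSeries.X : PowerSeries ℤ_[p]) →+ PrimaryTorsion (W.baseChange K).geomPoints p,
            (∀ (c : ℤ_[p]) (a : Submodule.torsionBy (PowerSeries ℤ_[p]) A₂ (PowerSeries.X : PowerSeries ℤ_[p])),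
                θ₀ (PowerSeries.C c • a) = c • θ₀ a) ∧ (∀ (σ : Field.absoluteGaloisGroup K)
                (a : Submodule.torsionBy (PowerSeries ℤ_[p]) A₂ (PowerSeries.X : PowerSeries ℤ_[p])),
                θ₀ (BigGaloisRep.torsionRep ρ₂ (PowerSeries.X : PowerSeries ℤ_[p]) σ a) = (W.baseChange K).primaryTorsionGaloisRep p σ (θ₀ a)) ∧
            Finite θ₀.ker ∧ Finite (PrimaryTorsion (W.baseChange K).geomPoints p ⧸ θ₀.range)) ∧
          (∀ k : ℕ, Function.Surjective (algebraMap ℤ_[p] (padicCoeffIntegers (D k).ι)) ∧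
            ∃ θ : Submodule.torsionBy (PowerSeries ℤ_[p]) A₂ (PowerSeries.X - PowerSeries.C (x k)) →+
                Cofree (D k).Δ.selfDualRep (padicCoeffField (D k).ι), (∀ (c : ℤ_[p])
                  (a : Submodule.torsionBy (PowerSeries ℤ_[p]) A₂ (PowerSeries.X - PowerSeries.C (x k))),
                  θ (PowerSeries.C c • a) = algebraMap ℤ_[p] (padicCoeffIntegers (D k).ι) c • θ a) ∧ (∀ (σ : Field.absoluteGaloisGroup K)
                  (a : Submodule.torsionBy (PowerSeries ℤ_[p]) A₂ (PowerSeries.X - PowerSeries.C (x k))),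
                  θ (BigGaloisRep.torsionRep ρ₂ (PowerSeries.X - PowerSeries.C (x k)) σ a) = (D k).Δ.selfDualCofreeRepOver K σ (θ a)) ∧
              Finite θ.ker ∧ Finite (Cofree (D k).Δ.selfDualRep (padicCoeffField (D k).ι) ⧸ θ.range))) →
        ∃ α : QuotSMulTop (PowerSeries.C (PowerSeries.X : PowerSeries ℤ_[p])) (XBig κ ρ₂ 𝔭bar (∅ : Set (HeightOneSpectrum (𝓞 K)))) →ₗ[PowerSeries
            (PowerSeries ℤ_[p])]
          (CharacterModule (TorsionControl.selmer (localMap K) (strictSet p 𝔭bar (∅ : Set (HeightOneSpectrum (𝓞 K))))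
            (TorsionControl.torsionRep (AnticyclotomicBigGaloisRep κ ρ₂) (PowerSeries.C (PowerSeries.X : PowerSeries ℤ_[p]))))),
          (∀ m ∈ LinearMap.ker α, ∃ s : PowerSeries (PowerSeries ℤ_[p]), ¬ ((PowerSeries.C (PowerSeries.X : PowerSeries ℤ_[p])) ∣ s) ∧ s • m = 0) ∧
          Finite ((CharacterModule (TorsionControl.selmer (localMap K) (strictSet p 𝔭bar (∅ : Set (HeightOneSpectrum (𝓞 K))))
            (TorsionControl.torsionRep (AnticyclotomicBigGaloisRep κ ρ₂) (PowerSeries.C (PowerSeries.X : PowerSeries ℤ_[p]))))) ⧸ LinearMap.range α))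
    (h4 : ∀ (W : WeierstrassCurve ℚ) [W.IsElliptic] [W.IsGloballyMinimal] (p : ℕ) [Fact p.Prime],
    ∀ (N : ℕ) [NeZero N] (K : Type) [Field K] [NumberField K] (Dt : ModularParametrizationData W N)
      (H : HeegnerDatum N (NumberField.discr K)) (ιK : K →+* ℂ) (P : (W.baseChange K).toAffine.Point), CellC W p → W.conductorNorm ℤ = N →
      IsImaginaryQuadratic K → NumberField.discr K < -4 → SatisfiesHeegnerHypothesis N K →
      (W.quadraticTwist (NumberField.discr K : ℚ)).entireLFunction 1 ≠ 0 →
      WeierstrassCurve.Affine.Point.map ιK.toRatAlgHom P = heegnerPointComplex Dt H → ¬ (p : ℤ) ∣ Dt.c → ¬ IsOfFinAddOrder P →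
      Odd (NumberField.discr K) → ∀ (κ : ZpExtension K p), κ.IsAnticyclotomic → ∀ (γ : Field.absoluteGaloisGroup K) [Fact (κ.IsTopGenerator γ)]
          (𝔭 : HeightOneSpectrum (𝓞 K)), ((p : ℕ) : 𝓞 K) ∈ 𝔭.asIdeal → 𝔭.asIdeal.ramificationIdx (𝓞 ℚ) = 1 → 𝔭.asIdeal.inertiaDeg (𝓞 ℚ) = 1 →
          ∀ (𝔭bar : HeightOneSpectrum (𝓞 K)), ((p : ℕ) : 𝓞 K) ∈ 𝔭bar.asIdeal → 𝔭bar ≠ 𝔭 → ((Ideal.span {(p : ℤ)}).primesOver (𝓞 K)).ncard = 2 →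
          ∀ (f : CuspForm (CongruenceSubgroup.Gamma0 N) 2), IsNewformOf W f → ∀ (ι' : PadicAlgCl p ≃+* ℂ), (∀ (w : InfinitePlace K) (k : 𝓞 K),
                k ∈ 𝔭.asIdeal ↔ ‖ι'.symm (w.embedding (k : K))‖ < 1) → ∀ (ΩK : ℂ) (Ωp : ℂ_[p]) (Q : PowerSeries 𝓞_ℂ_[p]), ΩK ≠ 0 → ‖Ωp‖ = 1 →
                R1.IsBDPLFunctionInt p ι' 𝔭 κ γ f ΩK Ωp Q →
      ∀ (L : PowerSeries (PowerSeries (unrIntegers p))) (x : ℕ → ℤ_[p]) (D : ℕ → Skinner2016.HidaCongruentForm W p 1),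
        (∀ k, ‖x k‖ < 1) ∧ Filter.Tendsto x Filter.atTop (nhds 0) ∧ (∃ e : ℕ, PowerSeries.C ((p : 𝓞_ℂ_[p]) ^ e) * Q ∈
          Ideal.span {PowerSeries.map (R1.unrToCpInt p) (PowerSeries.map (PowerSeries.constantCoeff (R := unrIntegers p)) L)}) ∧
        (∀ k : ℕ, (∀ y : coeffField (D k).g, ι' ((D k).ι y) = (y : ℂ)) ∧ 2 * ((p : ℤ) - 1) ∣ (D k).k - 2 ∧
          ∃ (ΩKg : ℂ) (Ωpg : ℂ_[p]) (Lg : UnrSeries p), ΩKg ≠ 0 ∧ ‖Ωpg‖ = 1 ∧ IsBDPLFunctionWt ι' 𝔭 κ γ (D k).g ΩKg Ωpg Lg ∧ ∃ Ψ : UnrSeries p,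
            (∃ U : PowerSeries (PowerSeries (unrIntegers p)), PowerSeries.map (PowerSeries.C (R := unrIntegers p)) Ψ =
                L + PowerSeries.C (PowerSeries.X - PowerSeries.C (toUnr p (x k))) * U) ∧
            (∃ e : ℕ, PowerSeries.C ((p : 𝓞_ℂ_[p]) ^ e) * PowerSeries.map (R1.unrToCpInt p) Ψ ∈
              Ideal.span {PowerSeries.map (R1.unrToCpInt p) Lg})) ∧ (∃ A : ℕ → UnrSeries p, ∀ ℓ : ℕ, ℓ.Prime → ¬ ℓ ∣ N →
          (∃ U : UnrSeries p, A ℓ = PowerSeries.C (toUnr p ((W.frobeniusTrace ℓ : ℤ) : ℤ_[p])) + PowerSeries.X * U) ∧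
          ∀ k : ℕ, ∃ (c : unrIntegers p) (U : UnrSeries p), A ℓ = PowerSeries.C c + (PowerSeries.X - PowerSeries.C (toUnr p (x k))) * U ∧
            ((c : ℂ_[p]) = algebraMap (PadicAlgCl p) ℂ_[p]
              ((D k).ι ⟨(UpperHalfPlane.qExpansion 1 ⇑(D k).g).coeff ℓ, coeff_mem_coeffField (D k).g ℓ⟩))) →
      ∀ [TopologicalSpace (PowerSeries ℤ_[p])] (A₂ : Type) [AddCommGroup A₂]
        [Module (PowerSeries ℤ_[p]) A₂] [TopologicalSpace A₂] [DiscreteTopology A₂]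
        (ρ₂ : ContinuousRep (Field.absoluteGaloisGroup K) (PowerSeries ℤ_[p]) A₂) [TopologicalSpace (PowerSeries (PowerSeries ℤ_[p]))]
        [ContinuousSMul (PowerSeries (PowerSeries ℤ_[p])) (BigRepModule (PowerSeries ℤ_[p]) p A₂)]
        [Module (PowerSeries ℤ_[p]) (XBig κ ρ₂ 𝔭bar (∅ : Set (HeightOneSpectrum (𝓞 K))))]
        [IsScalarTower (PowerSeries ℤ_[p]) (PowerSeries (PowerSeries ℤ_[p])) (XBig κ ρ₂ 𝔭bar (∅ : Set (HeightOneSpectrum (𝓞 K))))],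
        ((∀ a : A₂, ∃ n : ℕ, (PowerSeries.X : PowerSeries ℤ_[p]) ^ n • a = 0) ∧ (∀ a : A₂, ∃ b : A₂, (PowerSeries.X : PowerSeries ℤ_[p]) • b = a) ∧
          (∀ (k : ℕ) (a : A₂), ∃ b : A₂, (PowerSeries.X - PowerSeries.C (x k)) • b = a) ∧
          (∃ S₀ : Set (HeightOneSpectrum (𝓞 K)), S₀.Finite ∧ GaloisRep.IsUnramifiedOutside S₀ ρ₂ ∧
            ∀ w ∈ S₀, ((p : ℕ) : 𝓞 K) ∉ w.asIdeal → ((N : ℕ) : 𝓞 K) ∈ w.asIdeal) ∧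
          (∃ θ₀ : Submodule.torsionBy (PowerSeries ℤ_[p]) A₂ (PowerSeries.X : PowerSeries ℤ_[p]) →+ PrimaryTorsion (W.baseChange K).geomPoints p,
            (∀ (c : ℤ_[p]) (a : Submodule.torsionBy (PowerSeries ℤ_[p]) A₂ (PowerSeries.X : PowerSeries ℤ_[p])),
                θ₀ (PowerSeries.C c • a) = c • θ₀ a) ∧ (∀ (σ : Field.absoluteGaloisGroup K)
                (a : Submodule.torsionBy (PowerSeries ℤ_[p]) A₂ (PowerSeries.X : PowerSeries ℤ_[p])),
                θ₀ (BigGaloisRep.torsionRep ρ₂ (PowerSeries.X : PowerSeries ℤ_[p]) σ a) = (W.baseChange K).primaryTorsionGaloisRep p σ (θ₀ a)) ∧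
            Finite θ₀.ker ∧ Finite (PrimaryTorsion (W.baseChange K).geomPoints p ⧸ θ₀.range)) ∧
          (∀ k : ℕ, Function.Surjective (algebraMap ℤ_[p] (padicCoeffIntegers (D k).ι)) ∧
            ∃ θ : Submodule.torsionBy (PowerSeries ℤ_[p]) A₂ (PowerSeries.X - PowerSeries.C (x k)) →+
                Cofree (D k).Δ.selfDualRep (padicCoeffField (D k).ι), (∀ (c : ℤ_[p])
                  (a : Submodule.torsionBy (PowerSeries ℤ_[p]) A₂ (PowerSeries.X - PowerSeries.C (x k))),
                  θ (PowerSeries.C c • a) = algebraMap ℤ_[p] (padicCoeffIntegers (D k).ι) c • θ a) ∧ (∀ (σ : Field.absoluteGaloisGroup K)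
                  (a : Submodule.torsionBy (PowerSeries ℤ_[p]) A₂ (PowerSeries.X - PowerSeries.C (x k))),
                  θ (BigGaloisRep.torsionRep ρ₂ (PowerSeries.X - PowerSeries.C (x k)) σ a) = (D k).Δ.selfDualCofreeRepOver K σ (θ a)) ∧
              Finite θ.ker ∧ Finite (Cofree (D k).Δ.selfDualRep (padicCoeffField (D k).ι) ⧸ θ.range))) →
        ∃ m : ℕ, Ideal.span {PowerSeries.C ((p : ℤ_[p]) ^ m)} ≤ Literature.NumberTheory.EllipticCurves.Module.charIdeal (PowerSeries ℤ_[p])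
            (Submodule.torsionBy (PowerSeries (PowerSeries ℤ_[p])) (XBig κ ρ₂ 𝔭bar (∅ : Set (HeightOneSpectrum (𝓞 K))))
              (PowerSeries.C (PowerSeries.X : PowerSeries ℤ_[p])))) :
    (((((lambdaMu_multiplicative_of_gvPar ∧ thm16_charIdeal_dvd_multiplicative_of_reducible ∧
    thm61_splitMultiplicative ∧ thm61_nonsplitMultiplicative ∧
    (∀ (W : WeierstrassCurve ℚ) [W.IsElliptic] [W.IsGloballyMinimal] (p : ℕ) [Fact p.Prime], greenberg_stevens (W := W) (p := p)) ∧
    exists_isNewformOf ∧ hsieh2014_exists_anticyclotomicPAdicLFunction ∧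
    (∀ (N : ℕ) [NeZero N] (W : WeierstrassCurve ℚ) (K : Type) [Field K] [NumberField K], gross_zagier N W K) ∧
    (∀ (N : ℕ) [NeZero N] (W : WeierstrassCurve ℚ) (K : Type) [Field K] [NumberField K], kolyvagin N W K) ∧
    rank_eq_analyticRank_of_analyticRank_le_one ∧ HoffsteinLuo1997_exists_twist_L_one_ne_zero ∧
    mazur_not_dvd_maninConstant_of_odd ∧ bsdRHS_eq_of_isIsogenous) ∧ thm210_thm211_bdpDisplay_pNew) ∧
    LiuZhangZhang2018.thm151_thm153_modularCurve_heegnerVector) ∧ (prop125_characterGrSelmerDual_torsion_muZero_dim ∧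
      cor126_residualCharacter_globalLift ∧ cor126_residualCharacter_localSurjective ∧ thm212_exists_isKatzLFunction ∧
      Literature.NumberTheory.EllipticCurves.Castella2018.cas20_thm211_memberForms_sigmaFrames_congr)) ∧
      Literature.NumberTheory.EllipticCurves.BCGKPST2020.thm331_rubin_exists_katzMeasure₂_pseudoIso_span_eq ∧
      Literature.NumberTheory.EllipticCurves.DeShalit1987.thmII64_katzMeasure₂_functionalEquation ∧
      Literature.NumberTheory.EllipticCurves.Hida2010MuInvariant.thmI_mu_katzBranch_reflect_eq_zero) →
    ∀ (W : WeierstrassCurve ℚ) [W.IsElliptic] [W.IsGloballyMinimal] (p : ℕ) [Fact p.Prime],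
    ∀ (N : ℕ) [NeZero N] (K : Type) [Field K] [NumberField K] (Dt : ModularParametrizationData W N)
      (H : HeegnerDatum N (NumberField.discr K)) (ιK : K →+* ℂ) (P : (W.baseChange K).toAffine.Point), CellC W p → W.conductorNorm ℤ = N →
      IsImaginaryQuadratic K → NumberField.discr K < -4 → SatisfiesHeegnerHypothesis N K →
      (W.quadraticTwist (NumberField.discr K : ℚ)).entireLFunction 1 ≠ 0 →
      WeierstrassCurve.Affine.Point.map ιK.toRatAlgHom P = heegnerPointComplex Dt H → ¬ (p : ℤ) ∣ Dt.c → ¬ IsOfFinAddOrder P →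
      Odd (NumberField.discr K) → ∀ (κ : ZpExtension K p), κ.IsAnticyclotomic → ∀ (γ : Field.absoluteGaloisGroup K) [Fact (κ.IsTopGenerator γ)]
          (𝔭 : HeightOneSpectrum (𝓞 K)), ((p : ℕ) : 𝓞 K) ∈ 𝔭.asIdeal → 𝔭.asIdeal.ramificationIdx (𝓞 ℚ) = 1 → 𝔭.asIdeal.inertiaDeg (𝓞 ℚ) = 1 →
          ∀ (𝔭bar : HeightOneSpectrum (𝓞 K)), ((p : ℕ) : 𝓞 K) ∈ 𝔭bar.asIdeal → 𝔭bar ≠ 𝔭 → ((Ideal.span {(p : ℤ)}).primesOver (𝓞 K)).ncard = 2 →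
          ∀ (f : CuspForm (CongruenceSubgroup.Gamma0 N) 2), IsNewformOf W f → ∀ (ι' : PadicAlgCl p ≃+* ℂ), (∀ (w : InfinitePlace K) (k : 𝓞 K),
                k ∈ 𝔭.asIdeal ↔ ‖ι'.symm (w.embedding (k : K))‖ < 1) → ∀ (ΩK : ℂ) (Ωp : ℂ_[p]) (Q : PowerSeries 𝓞_ℂ_[p]), ΩK ≠ 0 → ‖Ωp‖ = 1 →
                R1.IsBDPLFunctionInt p ι' 𝔭 κ γ f ΩK Ωp Q →
      ∀ (L : PowerSeries (PowerSeries (unrIntegers p))) (x : ℕ → ℤ_[p]) (D : ℕ → Skinner2016.HidaCongruentForm W p 1),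
        (∀ k, ‖x k‖ < 1) ∧ Filter.Tendsto x Filter.atTop (nhds 0) ∧ (∃ e : ℕ, PowerSeries.C ((p : 𝓞_ℂ_[p]) ^ e) * Q ∈
          Ideal.span {PowerSeries.map (R1.unrToCpInt p) (PowerSeries.map (PowerSeries.constantCoeff (R := unrIntegers p)) L)}) ∧
        (∀ k : ℕ, (∀ y : coeffField (D k).g, ι' ((D k).ι y) = (y : ℂ)) ∧ 2 * ((p : ℤ) - 1) ∣ (D k).k - 2 ∧
          ∃ (ΩKg : ℂ) (Ωpg : ℂ_[p]) (Lg : UnrSeries p), ΩKg ≠ 0 ∧ ‖Ωpg‖ = 1 ∧ IsBDPLFunctionWt ι' 𝔭 κ γ (D k).g ΩKg Ωpg Lg ∧ ∃ Ψ : UnrSeries p,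
            (∃ U : PowerSeries (PowerSeries (unrIntegers p)), PowerSeries.map (PowerSeries.C (R := unrIntegers p)) Ψ =
                L + PowerSeries.C (PowerSeries.X - PowerSeries.C (toUnr p (x k))) * U) ∧
            (∃ e : ℕ, PowerSeries.C ((p : 𝓞_ℂ_[p]) ^ e) * PowerSeries.map (R1.unrToCpInt p) Ψ ∈
              Ideal.span {PowerSeries.map (R1.unrToCpInt p) Lg})) ∧ (∃ A : ℕ → UnrSeries p, ∀ ℓ : ℕ, ℓ.Prime → ¬ ℓ ∣ N →
          (∃ U : UnrSeries p, A ℓ = PowerSeries.C (toUnr p ((W.frobeniusTrace ℓ : ℤ) : ℤ_[p])) + PowerSeries.X * U) ∧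
          ∀ k : ℕ, ∃ (c : unrIntegers p) (U : UnrSeries p), A ℓ = PowerSeries.C c + (PowerSeries.X - PowerSeries.C (toUnr p (x k))) * U ∧
            ((c : ℂ_[p]) = algebraMap (PadicAlgCl p) ℂ_[p]
              ((D k).ι ⟨(UpperHalfPlane.qExpansion 1 ⇑(D k).g).coeff ℓ, coeff_mem_coeffField (D k).g ℓ⟩))) →
      ∀ [TopologicalSpace (PowerSeries ℤ_[p])] (A₂ : Type) [AddCommGroup A₂]
        [Module (PowerSeries ℤ_[p]) A₂] [TopologicalSpace A₂] [DiscreteTopology A₂]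
        (ρ₂ : ContinuousRep (Field.absoluteGaloisGroup K) (PowerSeries ℤ_[p]) A₂) [TopologicalSpace (PowerSeries (PowerSeries ℤ_[p]))]
        [ContinuousSMul (PowerSeries (PowerSeries ℤ_[p])) (BigRepModule (PowerSeries ℤ_[p]) p A₂)]
        [Module (PowerSeries ℤ_[p]) (XBig κ ρ₂ 𝔭bar (∅ : Set (HeightOneSpectrum (𝓞 K))))]
        [IsScalarTower (PowerSeries ℤ_[p]) (PowerSeries (PowerSeries ℤ_[p])) (XBig κ ρ₂ 𝔭bar (∅ : Set (HeightOneSpectrum (𝓞 K))))],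
        ((∀ a : A₂, ∃ n : ℕ, (PowerSeries.X : PowerSeries ℤ_[p]) ^ n • a = 0) ∧ (∀ a : A₂, ∃ b : A₂, (PowerSeries.X : PowerSeries ℤ_[p]) • b = a) ∧
          (∀ (k : ℕ) (a : A₂), ∃ b : A₂, (PowerSeries.X - PowerSeries.C (x k)) • b = a) ∧
          (∃ S₀ : Set (HeightOneSpectrum (𝓞 K)), S₀.Finite ∧ GaloisRep.IsUnramifiedOutside S₀ ρ₂ ∧
            ∀ w ∈ S₀, ((p : ℕ) : 𝓞 K) ∉ w.asIdeal → ((N : ℕ) : 𝓞 K) ∈ w.asIdeal) ∧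
          (∃ θ₀ : Submodule.torsionBy (PowerSeries ℤ_[p]) A₂ (PowerSeries.X : PowerSeries ℤ_[p]) →+ PrimaryTorsion (W.baseChange K).geomPoints p,
            (∀ (c : ℤ_[p]) (a : Submodule.torsionBy (PowerSeries ℤ_[p]) A₂ (PowerSeries.X : PowerSeries ℤ_[p])),
                θ₀ (PowerSeries.C c • a) = c • θ₀ a) ∧ (∀ (σ : Field.absoluteGaloisGroup K)
                (a : Submodule.torsionBy (PowerSeries ℤ_[p]) A₂ (PowerSeries.X : PowerSeries ℤ_[p])),
                θ₀ (BigGaloisRep.torsionRep ρ₂ (PowerSeries.X : PowerSeries ℤ_[p]) σ a) = (W.baseChange K).primaryTorsionGaloisRep p σ (θ₀ a)) ∧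
            Finite θ₀.ker ∧ Finite (PrimaryTorsion (W.baseChange K).geomPoints p ⧸ θ₀.range)) ∧
          (∀ k : ℕ, Function.Surjective (algebraMap ℤ_[p] (padicCoeffIntegers (D k).ι)) ∧
            ∃ θ : Submodule.torsionBy (PowerSeries ℤ_[p]) A₂ (PowerSeries.X - PowerSeries.C (x k)) →+
                Cofree (D k).Δ.selfDualRep (padicCoeffField (D k).ι), (∀ (c : ℤ_[p])
                  (a : Submodule.torsionBy (PowerSeries ℤ_[p]) A₂ (PowerSeries.X - PowerSeries.C (x k))),
                  θ (PowerSeries.C c • a) = algebraMap ℤ_[p] (padicCoeffIntegers (D k).ι) c • θ a) ∧ (∀ (σ : Field.absoluteGaloisGroup K)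
                  (a : Submodule.torsionBy (PowerSeries ℤ_[p]) A₂ (PowerSeries.X - PowerSeries.C (x k))),
                  θ (BigGaloisRep.torsionRep ρ₂ (PowerSeries.X - PowerSeries.C (x k)) σ a) = (D k).Δ.selfDualCofreeRepOver K σ (θ a)) ∧
              Finite θ.ker ∧ Finite (Cofree (D k).Δ.selfDualRep (padicCoeffField (D k).ι) ⧸ θ.range))) →
        Module.Finite (PowerSeries (PowerSeries ℤ_[p])) (XBig κ ρ₂ 𝔭bar (∅ : Set (HeightOneSpectrum (𝓞 K)))) ∧
        (∃ s : PowerSeries (PowerSeries ℤ_[p]), ¬ (PowerSeries.C (PowerSeries.X : PowerSeries ℤ_[p]) ∣ s) ∧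
            ∀ m : XBig κ ρ₂ 𝔭bar (∅ : Set (HeightOneSpectrum (𝓞 K))), s • m = 0) ∧ (∃ j : ℕ, Ideal.span {PowerSeries.C ((p : ℤ_[p]) ^ j)} *
            (Literature.NumberTheory.EllipticCurves.Module.charIdeal (PowerSeries (PowerSeries ℤ_[p]))
                (XBig κ ρ₂ 𝔭bar (∅ : Set (HeightOneSpectrum (𝓞 K))))).map (PowerSeries.map (PowerSeries.constantCoeff (R := ℤ_[p]))) ≤
          XAc.charIdeal (W.baseChange K) p κ 𝔭bar ∅ γ) := by
  intro hPub W _ _ p _ N _ K _ _ Dt H ιK P hC hN hK hdisc hHeeg hL1 hP hc hfin hodd κ hκ γ _ 𝔭 h𝔭 hram hdeg 𝔭bar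
    h𝔭bar hne hsp f hf ι' hι' ΩK Ωp Q hΩK hΩp hQ L x D hpkg _ A₂ _ _ _ _ ρ₂ _ _ _ _ hFD
  -- the two refereed names W3 consumes: «newform exists» (conjunct 6) and GZK (conjunct 10) of the cite stub
  have hnf : exists_isNewformOf := hPub.1.1.1.1.2.2.2.2.2.1
  have hGZK : rank_eq_analyticRank_of_analyticRank_le_one := hPub.1.1.1.1.2.2.2.2.2.2.2.2.2.1
  -- (fg) = W1 (ideator g37, by name)
  have hfg := TelescopeK2WeightTwoFg.bigModuleFinite W p N K Dt H ιK P hC hN hK hdisc hHeeg hL1 hP hc hfin hodd κ hκ γ 𝔭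
    h𝔭 hram hdeg 𝔭bar h𝔭bar hne hsp f hf ι' hι' ΩK Ωp Q hΩK hΩp hQ L x D hpkg A₂ ρ₂
    ⟨hFD.1, hFD.2.1, hFD.2.2.1, hFD.2.2.2.1.imp fun S₀ h => ⟨h.1, h.2.1⟩, hFD.2.2.2.2⟩
  haveI : Module.Finite (PowerSeries (PowerSeries ℤ_[p])) (XBig κ ρ₂ 𝔭bar (∅ : Set (HeightOneSpectrum (𝓞 K)))) := hfg
  -- W2: the control map
  obtain ⟨α, hkerα, hcokα⟩ := h2 W p N K Dt H ιK P hC hN hK hdisc hHeeg hL1 hP hc hfin hodd κ hκ γ 𝔭 h𝔭 hram hdeg 𝔭bar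
    h𝔭bar hne hsp f hf ι' hι' ΩK Ωp Q hΩK hΩp hQ L x D hpkg A₂ ρ₂ hFD
  -- W4: purity
  obtain ⟨m, hm⟩ := h4 W p N K Dt H ιK P hC hN hK hdisc hHeeg hL1 hP hc hfin hodd κ hκ γ 𝔭 h𝔭 hram hdeg 𝔭bar
    h𝔭bar hne hsp f hf ι' hι' ΩK Ωp Q hΩK hΩp hQ L x D hpkg A₂ ρ₂ hFD
  -- the `Λ`-structure on `Y` through `Λ → B` (the only one compatible with the `B`-structure)
  letI instΛY : Module (PowerSeries ℤ_[p]) (CharacterModule (TorsionControl.selmer (localMap K) (strictSet p 𝔭bar (∅ : Set (HeightOneSpectrum (𝓞 K))))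
            (TorsionControl.torsionRep (AnticyclotomicBigGaloisRep κ ρ₂) (PowerSeries.C (PowerSeries.X : PowerSeries ℤ_[p]))))) :=
    Module.compHom _ (algebraMap (PowerSeries ℤ_[p]) (PowerSeries (PowerSeries ℤ_[p])))
  haveI instTowY : IsScalarTower (PowerSeries ℤ_[p]) (PowerSeries (PowerSeries ℤ_[p]))
      (CharacterModule (TorsionControl.selmer (localMap K) (strictSet p 𝔭bar (∅ : Set (HeightOneSpectrum (𝓞 K))))
            (TorsionControl.torsionRep (AnticyclotomicBigGaloisRep κ ρ₂) (PowerSeries.C (PowerSeries.X : PowerSeries ℤ_[p]))))) :=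
    ⟨fun a b y => by
      change (algebraMap (PowerSeries ℤ_[p]) (PowerSeries (PowerSeries ℤ_[p])) a * b) • y =
        algebraMap (PowerSeries ℤ_[p]) (PowerSeries (PowerSeries ℤ_[p])) a • (b • y)
      exact mul_smul _ _ _⟩
  -- W3 (this line, by name, under the two refereed names): the `E`-side, for this structure
  obtain ⟨hYfg, hYtor, e, he⟩ := TelescopeK2WeightTwoOfPub.weightTwoTransport_of_pub hGZK hnf W p N K Dt H ιK P hC hN hK
    hdisc hHeeg hL1 hP hc hfin hodd κ hκ γ 𝔭 h𝔭 hram hdeg 𝔭bar h𝔭bar hne hsp f hf ι' hι' ΩK Ωp Q hΩK hΩp hQ L x D hpkg A₂ ρ₂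
    ⟨hFD.1, hFD.2.1, hFD.2.2.1, hFD.2.2.2.1.imp fun S₀ h => ⟨h.1, h.2.1⟩, hFD.2.2.2.2⟩
  haveI : Module.Finite (PowerSeries ℤ_[p]) (CharacterModule (TorsionControl.selmer (localMap K) (strictSet p 𝔭bar (∅ : Set (HeightOneSpectrum (𝓞 K))))
            (TorsionControl.torsionRep (AnticyclotomicBigGaloisRep κ ρ₂) (PowerSeries.C (PowerSeries.X : PowerSeries ℤ_[p]))))) := hYfg
  -- the retraction `φ₀ = (X ↦ 0) : B → Λ`, kernel `(C X)`
  have hφ₀C : ∀ g : PowerSeries ℤ_[p],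
      (PowerSeries.map (PowerSeries.constantCoeff (R := ℤ_[p])))
        (algebraMap (PowerSeries ℤ_[p]) (PowerSeries (PowerSeries ℤ_[p])) g) = g := by
    intro g
    change PowerSeries.map (PowerSeries.constantCoeff (R := ℤ_[p]))
      (PowerSeries.map (PowerSeries.C (R := ℤ_[p])) g) = g
    refine PowerSeries.ext fun n => ?_
    simp only [PowerSeries.coeff_map, PowerSeries.constantCoeff_C]
  have hφ₀π : (PowerSeries.map (PowerSeries.constantCoeff (R := ℤ_[p]))) (PowerSeries.C (PowerSeries.X : PowerSeries ℤ_[p])) = 0 := by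
    rw [PowerSeries.map_C, PowerSeries.constantCoeff_X, map_zero]
  have hφ₀ker : ∀ b : PowerSeries (PowerSeries ℤ_[p]),
      (PowerSeries.map (PowerSeries.constantCoeff (R := ℤ_[p]))) b = 0 → (PowerSeries.C (PowerSeries.X : PowerSeries ℤ_[p])) ∣ b :=
    fun b hb => TelescopeK2DivIntOfModuleDiv.C_X_dvd_of_map_constantCoeff_eq_zero b hb
  have hπ₀0 : ((PowerSeries.C (PowerSeries.X : PowerSeries ℤ_[p])) : PowerSeries (PowerSeries ℤ_[p])) ≠ 0 := by
    intro h
    have h1 := congrArg (PowerSeries.constantCoeff (R := PowerSeries ℤ_[p])) h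
    rw [PowerSeries.constantCoeff_C, map_zero] at h1
    exact PowerSeries.X_ne_zero h1
  -- `Q := X₂/(C X)X₂` is finitely generated over `Λ`
  haveI hQfg : Module.Finite (PowerSeries ℤ_[p]) (QuotSMulTop (PowerSeries.C (PowerSeries.X : PowerSeries ℤ_[p])) (XBig κ ρ₂ 𝔭bar (∅ : Set
      (HeightOneSpectrum (𝓞 K))))) :=
    RetractionSpecialization.moduleFinite_quotSMulTop_of_retraction hφ₀C hφ₀ker
  -- `α` read `Λ`-linearly
  let α' : QuotSMulTop (PowerSeries.C (PowerSeries.X : PowerSeries ℤ_[p])) (XBig κ ρ₂ 𝔭bar (∅ : Set (HeightOneSpectrum (𝓞 K)))) →ₗ[PowerSeries ℤ_[p]]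
      (CharacterModule (TorsionControl.selmer (localMap K) (strictSet p 𝔭bar (∅ : Set (HeightOneSpectrum (𝓞 K))))
            (TorsionControl.torsionRep (AnticyclotomicBigGaloisRep κ ρ₂) (PowerSeries.C (PowerSeries.X : PowerSeries ℤ_[p]))))) := α.restrictScalars
                (PowerSeries ℤ_[p])
  -- (reg₀), step 1: `Q` is `Λ`-torsion
  have hQtor : Module.IsTorsion (PowerSeries ℤ_[p]) (QuotSMulTop (PowerSeries.C (PowerSeries.X : PowerSeries ℤ_[p])) (XBig κ ρ₂ 𝔭bar (∅ : Set
      (HeightOneSpectrum (𝓞 K))))) := by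
    intro q
    obtain ⟨⟨a, ha⟩, haq⟩ := @hYtor (α' q)
    have ha0 : a ≠ 0 := nonZeroDivisors.ne_zero ha
    have hmem : a • q ∈ LinearMap.ker α := by
      rw [LinearMap.mem_ker, ← algebraMap_smul (PowerSeries (PowerSeries ℤ_[p])) a q, map_smul,
        algebraMap_smul]
      exact haq
    obtain ⟨s, hsπ, hs⟩ := hkerα _ hmem
    have hs0 : (PowerSeries.map (PowerSeries.constantCoeff (R := ℤ_[p]))) s ≠ 0 := fun h => hsπ (hφ₀ker s h)
    refine ⟨⟨(PowerSeries.map (PowerSeries.constantCoeff (R := ℤ_[p]))) s * a,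
      mem_nonZeroDivisors_of_ne_zero (mul_ne_zero hs0 ha0)⟩, ?_⟩
    change ((PowerSeries.map (PowerSeries.constantCoeff (R := ℤ_[p]))) s * a) • q = 0
    -- `s ≡ φ₀ s (mod C X)` and `C X` kills `Q`
    have hdiff : (s - algebraMap (PowerSeries ℤ_[p]) (PowerSeries (PowerSeries ℤ_[p]))
        ((PowerSeries.map (PowerSeries.constantCoeff (R := ℤ_[p]))) s)) • (a • q) = 0 :=
      RetractionSpecialization.smul_quotSMulTop_eq_zero' hφ₀ker _ _ (by rw [map_sub, hφ₀C, sub_self])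
    rw [sub_smul, sub_eq_zero, algebraMap_smul] at hdiff
    rw [mul_smul, ← hdiff]
    exact hs
  -- (reg₀), step 2: the determinant trick (x2-p2 g18, by name)
  have hreg : ∃ s : PowerSeries (PowerSeries ℤ_[p]), ¬ ((PowerSeries.C (PowerSeries.X : PowerSeries ℤ_[p])) ∣ s) ∧ ∀ m : (XBig κ ρ₂ 𝔭bar (∅ : Set
      (HeightOneSpectrum (𝓞 K)))), s • m = 0 :=
    RetractionSpecialization.exists_not_dvd_smul_eq_zero_of_isTorsion_quotSMulTop hφ₀C hφ₀π hφ₀ker hQtor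
  refine ⟨hfg, hreg, ?_⟩
  -- (div₀)
  obtain ⟨s₀, hs₀π, hs₀⟩ := hreg
  have hs₀' : ∃ s : PowerSeries (PowerSeries ℤ_[p]),
      (PowerSeries.map (PowerSeries.constantCoeff (R := ℤ_[p]))) s ≠ 0 ∧ ∀ m : (XBig κ ρ₂ 𝔭bar (∅ : Set (HeightOneSpectrum (𝓞 K)))), s • m = 0 :=
    ⟨s₀, fun h => hs₀π (hφ₀ker _ h), hs₀⟩
  -- two-sided Herbrand at `X ↦ 0` (p729686, by name)
  haveI hufdB : UniqueFactorizationMonoid (PowerSeries (PowerSeries ℤ_[p])) :=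
    Literature.NumberTheory.IwasawaTheory.uniqueFactorizationMonoid_powerSeries_powerSeries ℤ_[p]
  have hHer := RetractionSpecialization.charIdeal_quotSMulTop_eq_mul_of_retraction hφ₀C hφ₀π hφ₀ker hπ₀0
    (XBig κ ρ₂ 𝔭bar (∅ : Set (HeightOneSpectrum (𝓞 K)))) hs₀'
  -- `char_Λ(Q) ⊆ char_Λ(Y)` along `α'`
  have hQ : Literature.NumberTheory.EllipticCurves.Module.charIdeal (PowerSeries ℤ_[p]) (QuotSMulTop (PowerSeries.C (PowerSeries.X : PowerSeries
      ℤ_[p])) (XBig κ ρ₂ 𝔭bar (∅ : Set (HeightOneSpectrum (𝓞 K))))) ≤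
      Literature.NumberTheory.EllipticCurves.Module.charIdeal (PowerSeries ℤ_[p]) (LinearMap.range α') := by
    rw [Literature.NumberTheory.EllipticCurves.Module.charIdeal_eq_mul_of_exact hQtor
      (LinearMap.ker α'.rangeRestrict).subtype α'.rangeRestrict (Submodule.injective_subtype _)
      (LinearMap.surjective_rangeRestrict α') (LinearMap.exact_subtype_ker_map _)]
    exact Ideal.mul_le_left
  have hfinq : Finite ((CharacterModule (TorsionControl.selmer (localMap K) (strictSet p 𝔭bar (∅ : Set (HeightOneSpectrum (𝓞 K))))
            (TorsionControl.torsionRep (AnticyclotomicBigGaloisRep κ ρ₂) (PowerSeries.C (PowerSeries.X : PowerSeries ℤ_[p]))))) ⧸ LinearMap.range α') := by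
    have hr : LinearMap.range α' = (LinearMap.range α).restrictScalars (PowerSeries ℤ_[p]) :=
      LinearMap.range_restrictScalars α
    rw [hr]
    exact Finite.of_equiv _ (Submodule.Quotient.restrictScalarsEquiv (PowerSeries ℤ_[p]) (LinearMap.range α)).symm.toEquiv
  haveI := hfinq
  have htop : Literature.NumberTheory.EllipticCurves.Module.charIdeal (PowerSeries ℤ_[p])
      ((CharacterModule (TorsionControl.selmer (localMap K) (strictSet p 𝔭bar (∅ : Set (HeightOneSpectrum (𝓞 K))))
            (TorsionControl.torsionRep (AnticyclotomicBigGaloisRep κ ρ₂) (PowerSeries.C (PowerSeries.X : PowerSeries ℤ_[p]))))) ⧸ LinearMap.range α') = ⊤ :=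
    Literature.NumberTheory.EllipticCurves.Module.charIdeal_eq_top_of_isPseudoNull
      (Literature.NumberTheory.EllipticCurves.isPseudoNull_of_finite p
        ((CharacterModule (TorsionControl.selmer (localMap K) (strictSet p 𝔭bar (∅ : Set (HeightOneSpectrum (𝓞 K))))
            (TorsionControl.torsionRep (AnticyclotomicBigGaloisRep κ ρ₂) (PowerSeries.C (PowerSeries.X : PowerSeries ℤ_[p]))))) ⧸ LinearMap.range α'))
  have hY : Literature.NumberTheory.EllipticCurves.Module.charIdeal (PowerSeries ℤ_[p]) (LinearMap.range α') =
      Literature.NumberTheory.EllipticCurves.Module.charIdeal (PowerSeries ℤ_[p]) (CharacterModule (TorsionControl.selmer (localMap K) (strictSet p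
          𝔭bar (∅ : Set (HeightOneSpectrum (𝓞 K))))
            (TorsionControl.torsionRep (AnticyclotomicBigGaloisRep κ ρ₂) (PowerSeries.C (PowerSeries.X : PowerSeries ℤ_[p]))))) := by
    rw [Literature.NumberTheory.EllipticCurves.Module.charIdeal_eq_mul_of_exact hYtor
      (LinearMap.range α').subtype (LinearMap.range α').mkQ (Submodule.injective_subtype _)
      (Submodule.mkQ_surjective _) (LinearMap.exact_subtype_mkQ _), htop, Ideal.mul_top]
  -- assemble: `(p^(e+m))·φ₀(char_B X₂) ⊆ (p^e)·char_Λ(Q) ⊆ (p^e)·char_Λ(Y) ⊆ Ch_Λ(X_ac)`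
  refine ⟨e + m, ?_⟩
  have hsplit : Ideal.span {PowerSeries.C ((p : ℤ_[p]) ^ (e + m))} =
      Ideal.span {PowerSeries.C ((p : ℤ_[p]) ^ e)} * Ideal.span {PowerSeries.C ((p : ℤ_[p]) ^ m)} := by
    rw [Ideal.span_singleton_mul_span_singleton, ← map_mul, ← pow_add]
  rw [hsplit, mul_assoc]
  refine le_trans (Ideal.mul_mono_right ?_) he
  calc Ideal.span {PowerSeries.C ((p : ℤ_[p]) ^ m)} *
        (Literature.NumberTheory.EllipticCurves.Module.charIdeal (PowerSeries (PowerSeries ℤ_[p])) (XBig κ ρ₂ 𝔭bar (∅ : Set (HeightOneSpectrum (𝓞 K))))).map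
          (PowerSeries.map (PowerSeries.constantCoeff (R := ℤ_[p])))
      ≤ Literature.NumberTheory.EllipticCurves.Module.charIdeal (PowerSeries ℤ_[p])
            (Submodule.torsionBy (PowerSeries (PowerSeries ℤ_[p])) (XBig κ ρ₂ 𝔭bar (∅ : Set (HeightOneSpectrum (𝓞 K)))) (PowerSeries.C (PowerSeries.X
                : PowerSeries ℤ_[p]))) *
          (Literature.NumberTheory.EllipticCurves.Module.charIdeal (PowerSeries (PowerSeries ℤ_[p])) (XBig κ ρ₂ 𝔭bar (∅ : Set (HeightOneSpectrum (𝓞 K))))).map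
            (PowerSeries.map (PowerSeries.constantCoeff (R := ℤ_[p]))) := Ideal.mul_mono_left hm
    _ = Literature.NumberTheory.EllipticCurves.Module.charIdeal (PowerSeries ℤ_[p]) (QuotSMulTop (PowerSeries.C (PowerSeries.X : PowerSeries ℤ_[p]))
        (XBig κ ρ₂ 𝔭bar (∅ : Set (HeightOneSpectrum (𝓞 K))))) := hHer.symm
    _ ≤ Literature.NumberTheory.EllipticCurves.Module.charIdeal (PowerSeries ℤ_[p]) (LinearMap.range α') := hQ
    _ = Literature.NumberTheory.EllipticCurves.Module.charIdeal (PowerSeries ℤ_[p]) (CharacterModule (TorsionControl.selmer (localMap K) (strictSet p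
        𝔭bar (∅ : Set (HeightOneSpectrum (𝓞 K))))
            (TorsionControl.torsionRep (AnticyclotomicBigGaloisRep κ ρ₂) (PowerSeries.C (PowerSeries.X : PowerSeries ℤ_[p]))))) := hY
end Summit.BirchSwinnertonDyer.BirchSwinnertonDyer.Theorems.TelescopeK2WeightTwoControlOfPubOfSubleavesNp
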